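import Summits.AtomisticToContinuum.Crystallization.Theorems.FrustratedLawDichotomyAperiodicGapFiniteCut
import Summits.AtomisticToContinuum.Crystallization.Theses.PalmUnimodularRigidity

/-!
# FrustratedLawDichotomy · crux `AperiodicFrustratedLawGap` (stmt-AtomisticToContinuum-27623) — PALM MINIMISERS CHARGE NO FINITE CLUSTER
# (decomp-a2c, prover hand 2, structural share)

`ae_infinite_of_minimising`: granted the energy floor `e⋆ ≤ E_P[rootEnergy]` for point-stationary hard-core probability laws (item 9229
`PalmUnimodularRigidity.UnimodularEnergyLowerBound`, PROVED in the tree; taken as a hypothesis in Literature vocabulary because its Theorems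
module does not build on the farm at the time of writing, and discharged from the route decl in `ae_infinite_of_minimising_of_decl`), every
MINIMISING point-stationary `δ`-hard-core probability law (`E_P[rootEnergy] ≤ e⋆`) is almost surely carried by INFINITE configurations.

Proof: condition on the re-rooting-invariant event `{μ univ ≠ ∞}` (`isPointStationaryLaw_restrict_of_invariant`); if it had positive mass, the
conditioned law would be a finite-cluster law with a STRICT gap (`eStar_lt_integral_rootEnergy_of_ae_finite`), the complementary conditioned law
obeys the floor, and the two pieces would add up to `E_P[rootEnergy] > e⋆`.  This is the degenerate (zero-dimensional) case of cohesion of Palm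
minimisers (cf. `IsometryAtoms.MinimisingLawsCohesive`), and the form in which the finite class leaves the crux: a counterexample to
`AperiodicFrustratedLawGap` is automatically almost surely infinite.  All `[folklore]`.
-/

noncomputable section

namespace Summit.AtomisticToContinuum.Crystallization.Theorems.FrustratedLawDichotomyAperiodicGapFiniteCut

open MeasureTheory Metric Set Filter ProbabilityTheory
open scoped ENNReal Topology BigOperators
open Literature.MathematicalPhysics.StatisticalMechanics Literature.Probability.Process
open Summit.AtomisticToContinuum.Crystallization.Theorems.ChargedEnergyGapNegative (E3 eStar)
open Summit.AtomisticToContinuum.Crystallization.Theorems.FrustratedLawDichotomyFiniteClusterGap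
  (count_restrict_univ_of_finite count_restrict_univ_of_infinite setOf_count_restrict_singleton_ne_zero
    card_mul_eStar_lt_interactionEnergy eStar_lt_integral_rootEnergy_of_ae_finite map_sub_univ)

section MinimisersInfinite

variable {δ : ℝ} {P : Measure (Measure E3)}

/-- Non-strict companion of `setIntegral_ge_of_cond`: a floor for the conditioned law `(P K)⁻¹ • P|K` is a floor `(P K)·c ≤ ∫_K f dP`.
[folklore] -/
theorem setIntegral_ge_of_cond_le [IsProbabilityMeasure P] {K : Set (Measure E3)} {f : Measure E3 → ℝ} {c : ℝ}
    (hfloor : P K ≠ 0 → c ≤ ∫ μ, f μ ∂((P K)⁻¹ • P.restrict K)) :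
    (P K).toReal * c ≤ ∫ μ in K, f μ ∂P := by
  by_cases hK0 : P K = 0
  · rw [hK0, ENNReal.toReal_zero, zero_mul, Measure.restrict_eq_zero.2 hK0, integral_zero_measure]
  · have hpos : 0 < (P K).toReal := ENNReal.toReal_pos hK0 (measure_ne_top P K)
    have h := hfloor hK0
    rw [integral_smul_measure, ENNReal.toReal_inv, smul_eq_mul] at h
    have := mul_le_mul_of_nonneg_left h hpos.le
    rwa [← mul_assoc, mul_inv_cancel₀ hpos.ne', one_mul] at this

/-- `e⋆ < 0`. [folklore] -/
private theorem eStar_neg₃ : eStar < 0 := by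
  have h := card_mul_eStar_lt_interactionEnergy (N := 1) one_pos (x := fun _ => (0 : E3)) (fun i j _ => Subsingleton.elim i j)
  rw [interactionEnergy_of_subsingleton] at h
  simpa using h

/-- **Palm minimisers charge no finite cluster.**  Granted the energy floor for point-stationary `δ'`-hard-core probability laws (every
`δ' > 0`; item 9229, proved in the tree), a point-stationary `δ`-hard-core probability law with `E_P[rootEnergy V_LJ] ≤ e⋆` is almost surely
carried by INFINITE configurations. [folklore] -/
theorem ae_infinite_of_minimising
    (hU : ∀ δ' : ℝ, 0 < δ' → ∀ Q : Measure (Measure E3), IsProbabilityMeasure Q → (∀ᵐ μ ∂Q, IsRootedHardCore δ' μ) →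
      IsPointStationaryLaw Q → eStar ≤ ∫ μ, rootEnergy lennardJones μ ∂Q)
    (hδ : 0 < δ) [IsProbabilityMeasure P] (hcore : ∀ᵐ μ ∂P, IsRootedHardCore δ μ) (hstat : IsPointStationaryLaw P)
    (hmin : ∫ μ, rootEnergy lennardJones μ ∂P ≤ eStar) :
    ∀ᵐ μ ∂P, {p : E3 | μ {p} ≠ 0}.Infinite := by
  -- the invariant event of finite total mass
  set K : Set (Measure E3) := {μ : Measure E3 | μ univ ≠ ∞} with hKdef
  have hK : MeasurableSet K := ((Measure.measurable_coe MeasurableSet.univ) (measurableSet_singleton ∞)).compl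
  have hinvK : ∀ μ : Measure E3, ∀ p : E3, μ {p} ≠ 0 → (μ ∈ K ↔ Measure.map (fun z : E3 => z - p) μ ∈ K) :=
    fun μ p _ => by simp only [hKdef, Set.mem_setOf_eq, map_sub_univ]
  have hinvKc : ∀ μ : Measure E3, ∀ p : E3, μ {p} ≠ 0 → (μ ∈ Kᶜ ↔ Measure.map (fun z : E3 => z - p) μ ∈ Kᶜ) :=
    fun μ p hp => by rw [Set.mem_compl_iff, Set.mem_compl_iff, hinvK μ p hp]
  -- it suffices that `K` is null
  suffices hKnull : P K = 0 by
    filter_upwards [hcore, measure_eq_zero_iff_ae_notMem.1 hKnull] with μ hμ hμK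
    obtain ⟨S, h0S, hsep, rfl⟩ := hμ
    rw [setOf_count_restrict_singleton_ne_zero]
    intro hS
    exact hμK (by rw [hKdef, Set.mem_setOf_eq, count_restrict_univ_of_finite hS]; exact ENNReal.natCast_ne_top _)
  by_contra hK0
  -- integrability (else `∫ = 0 > e⋆` contradicts minimality outright)
  by_cases hint : Integrable (fun μ : Measure E3 => rootEnergy lennardJones μ) P
  swap
  · rw [integral_undef hint] at hmin
    exact absurd hmin (not_le.2 eStar_neg₃)
  -- conditioned laws stay in the frame
  have hframe : ∀ (L : Set (Measure E3)), MeasurableSet L →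
      (∀ μ : Measure E3, ∀ p : E3, μ {p} ≠ 0 → (μ ∈ L ↔ Measure.map (fun z : E3 => z - p) μ ∈ L)) → P L ≠ 0 →
      IsProbabilityMeasure ((P L)⁻¹ • P.restrict L) ∧ (∀ᵐ μ ∂((P L)⁻¹ • P.restrict L), IsRootedHardCore δ μ) ∧
      IsPointStationaryLaw ((P L)⁻¹ • P.restrict L) ∧ (∀ᵐ μ ∂((P L)⁻¹ • P.restrict L), μ ∈ L) := fun L hL hinvL hL0 =>
    ⟨isProbabilityMeasure_cond' hL0, Measure.ae_smul_measure (ae_restrict_of_ae hcore) _,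
      (isPointStationaryLaw_restrict_of_invariant hδ hcore hstat hL hinvL).smul _, Measure.ae_smul_measure (ae_restrict_mem hL) _⟩
  -- the finite piece: STRICT gap
  have hpieceK := setIntegral_ge_of_cond (P := P) (K := K) (f := fun μ => rootEnergy lennardJones μ) (c := eStar) (fun hK0' => by
    obtain ⟨hP', ha', hb', hK'⟩ := hframe K hK hinvK hK0'
    refine eStar_lt_integral_rootEnergy_of_ae_finite hδ ha' hb' ?_
    filter_upwards [ha', hK'] with μ hμ hμK
    obtain ⟨S, h0S, hsep, rfl⟩ := hμ
    rw [setOf_count_restrict_singleton_ne_zero]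
    by_contra hS
    exact hμK (count_restrict_univ_of_infinite hS))
  -- the infinite piece: the floor
  have hpieceKc := setIntegral_ge_of_cond_le (P := P) (K := Kᶜ) (f := fun μ => rootEnergy lennardJones μ) (c := eStar) (fun hK0' => by
    obtain ⟨hP', ha', hb', -⟩ := hframe Kᶜ hK.compl hinvKc hK0'
    exact hU δ hδ _ hP' ha' hb')
  -- add up
  have hsum : ∫ μ in K, rootEnergy lennardJones μ ∂P + ∫ μ in Kᶜ, rootEnergy lennardJones μ ∂P =
      ∫ μ, rootEnergy lennardJones μ ∂P := integral_add_compl hK hint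
  have hmass : (P K).toReal + (P Kᶜ).toReal = 1 := by
    rw [← ENNReal.toReal_add (measure_ne_top P K) (measure_ne_top P Kᶜ), measure_add_measure_compl hK, measure_univ, ENNReal.toReal_one]
  have hm' : (P K).toReal * eStar + (P Kᶜ).toReal * eStar = eStar := by rw [← add_mul, hmass, one_mul]
  have h1 := hpieceK.2 hK0
  rw [← hsum] at hmin
  linarith

/-- **Palm minimisers charge no finite cluster** — with the floor discharged from the route decl
`PalmUnimodularRigidity.UnimodularEnergyLowerBound` (item 9229, proved: `Theorems.unimodularEnergyLowerBound_proof`). [folklore] -/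
theorem ae_infinite_of_minimising_of_decl
    (hU : Summit.AtomisticToContinuum.Crystallization.Theses.PalmUnimodularRigidity.UnimodularEnergyLowerBound)
    (hδ : 0 < δ) [IsProbabilityMeasure P] (hcore : ∀ᵐ μ ∂P, IsRootedHardCore δ μ) (hstat : IsPointStationaryLaw P)
    (hmin : ∫ μ, rootEnergy lennardJones μ ∂P ≤ eStar) :
    ∀ᵐ μ ∂P, {p : E3 | μ {p} ≠ 0}.Infinite :=
  ae_infinite_of_minimising (fun δ' hδ' Q hQ hc hs => hU δ' hδ' Q hQ hc hs) hδ hcore hstat hmin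

end MinimisersInfinite

end Summit.AtomisticToContinuum.Crystallization.Theorems.FrustratedLawDichotomyAperiodicGapFiniteCut

end
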